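import Summits.BirchSwinnertonDyer.BirchSwinnertonDyer.Theorems.ClassRecordThreeEulerHalvesAtThreeCartanOrderMachineUnramified
import Summits.BirchSwinnertonDyer.BirchSwinnertonDyer.Theorems.ClassRecordThreeCornerAtThreeShimuraSwapFamilyCebotarev
import HarnessLib

/-!
# The ČEBOTAREV binder `hceb` of the family swap at `p = 3` on UNRAMIFIED frames (Cartan road of crux `EulerHalvesAtThree`,
# item stmt-BirchSwinnertonDyer-19109; child item 23422; `--supports 19109`, helper)

bsd-idea-10 g9 (ideator, lens = transfer), at the request of the lead `bsd-stepL-tam3-p1` g20 (22:13Z, «take hceb-on-unramified-frames»)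
for its (DIV_C) port. The tree's `Koly.hceb_family_three_of_mem_inertSet` (`…ShimuraSwapFamilyCebotarev`, file 6 of the P1 port-spec)
is keyed to the EICHLER locus — «every prime of `N` off the inert set `S` SPLITS in `K`» (`hsplit`) and `3 ∈ S` — only because it takes
the four image inputs from `kolyvaginImageInputs_three_of_mem_inertSet`. On the Cartan locus the primes of the Cartan set are inert and
unramified with `q² ∥ N`, so `hsplit` fails; but the image inputs need only «every prime of `N` is UNRAMIFIED in `K`» and `3 ∤ d_K`
(Gross's disjointness prime `q ∣ d_K`, `q ∤ 3N`: `ShimuraKolyvaginOfImage.kolyvaginImageInputs_three_of_unramified`, p672011), and the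
Čebotarev engine `hceb_family_ofImage` is blind to `K`'s splitting. This file states the two re-keyed forms (the tree's Eichler-locus theorem is the special case `hsplit ∧ 3 ∈ S`: split ⇒
unramified by `ShimuraKolyvaginImageInputs.not_dvd_discr_of_ncard_primesOver_eq_two`, `3 ∈ S ⇒ 3 ∤ d_K` by `hin` — not restated, `dedup.landed`):

* `hceb_family_three_of_unramifiedN` — binders `hunrN : ∀ ℓ prime, ℓ ∣ N → ℓ ∤ d_K` and `3 ∤ d_K`;
* `hceb_family_three_of_unramified` — the frame-shaped binders of the Cartan display: the inert clause `hin` on `S` VERBATIM, the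
  unramified clause `hunr : ∀ ℓ prime, ℓ ∣ N → ℓ ∉ S → ℓ ∤ d_K` off `S`, and `3 ∤ d_K` (the Eichler locus `hsplit ∧ 3 ∈ S` and the
  Cartan locus are special cases: split ⇒ unramified, `ShimuraKolyvaginImageInputs.not_dvd_discr_of_ncard_primesOver_eq_two`).

Nothing here is new mathematics (two corollaries of tree theorems). UNCONDITIONAL given the binders. No summit statement, no route
crux and no item is proved by this file. [cite: McCallumLMS1991, §3 Cor. 3.2] [cite: Jetchev2008, Lemma 5.1 (p. 821)]
[cite: GrossLMS1991, §3 (3.2), §9 (PDF p. 227) and Prop. 9.3] beyond-print theorem: no.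
-/

noncomputable section

open scoped Classical NumberField

namespace Summit.BirchSwinnertonDyer.Rank1Residual.X11b.Three.Koly

open WeierstrassCurve IsDedekindDomain NumberField Literature.NumberTheory.EllipticCurves
  Literature.NumberTheory.EllipticCurves.KolyvaginCocycle Literature.NumberTheory.GaloisRepresentations
  Literature.NumberTheory.GaloisCohomology
  Summit.BirchSwinnertonDyer.BirchSwinnertonDyer.Theorems

variable (W : WeierstrassCurve ℚ) [W.IsElliptic] {K : Type} [Field K] [NumberField K]

/-- **File 5's Čebotarev binder `hceb` at `3` when EVERY prime of `N = N_E` is unramified in `K` and `3 ∤ d_K`** (`E[3]`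
irreducible, onto or not; `K` imaginary quadratic): the four image inputs from
`ShimuraKolyvaginOfImage.kolyvaginImageInputs_three_of_unramified`, then `hceb_family_ofImage`. UNCONDITIONAL.
[cite: McCallumLMS1991, §3 Cor. 3.2] [cite: GrossLMS1991, §3 (3.2), Prop. 9.3] -/
theorem hceb_family_three_of_unramifiedN [Fact (Nat.Prime 3)] {N : ℕ} [NeZero N]
    (hN : W.conductorNorm ℤ = N) (hirr : W.HasIrreducibleModPGaloisRep 3) (hK : IsImaginaryQuadratic K)
    (hunrN : ∀ ℓ : ℕ, ℓ.Prime → ℓ ∣ N → ¬ (ℓ : ℤ) ∣ NumberField.discr K)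
    (h3d : ¬ (3 : ℤ) ∣ NumberField.discr K) :
    ∀ (τ : K ≃ₐ[ℚ] K), τ ≠ 1 → ∀ (j : ℕ) (e₁ : ℤ), (e₁ = 1 ∨ e₁ = -1) →
      ∀ (x y : galoisCohomology ((W.baseChange K).torsionGaloisModule ((3 ^ 1 : ℕ) : ℤ)) 1),
      conjAct W τ ((3 ^ 1 : ℕ) : ℤ) x = e₁ • x → conjAct W τ ((3 ^ 1 : ℕ) : ℤ) y = (-e₁) • y → y ≠ 0 →
      ∀ (b : ℕ), ∃ ℓ : ℕ, b < ℓ ∧ IsKolyvaginPrime N W K 3 ℓ ∧ FrobEqFrobInfty W K (3 ^ (1 + j)) ℓ ∧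
        ∀ v : HeightOneSpectrum (𝓞 K), (ℓ : 𝓞 K) ∈ v.asIdeal →
          addOrderOf (galoisCohomology.localization
              ((W.baseChange K).torsionGaloisModule ((3 ^ 1 : ℕ) : ℤ)) (Sum.inr v) 1 x) = addOrderOf x ∧
          addOrderOf (galoisCohomology.localization
              ((W.baseChange K).torsionGaloisModule ((3 ^ 1 : ℕ) : ℤ)) (Sum.inr v) 1 y) = addOrderOf y := by
  have h3d' : ¬ ((3 : ℕ) : ℤ) ∣ NumberField.discr K := by exact_mod_cast h3d
  obtain ⟨hIz, hIs, hIc, hIt⟩ :=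
    ShimuraKolyvaginOfImage.kolyvaginImageInputs_three_of_unramified K W hN hirr hK hunrN h3d'
  exact hceb_family_ofImage W (N := N) hK (by decide) hIz hIs hIc hIt

/-- **File 5's Čebotarev binder `hceb` on the UNRAMIFIED Shimura frames at `3` of the Cartan road** (crux 19109, child item 23422):
`S` the inert-unramified level primes (clause `hin` VERBATIM as in the saved displays), every OTHER prime of `N` unramified in `K`
(`hunr` — split OR Cartan-inert), `3 ∤ d_K`. `hceb_family_three_of_mem_inertSet` is the special case `hsplit ∧ 3 ∈ S`.
UNCONDITIONAL. [cite: McCallumLMS1991, §3 Cor. 3.2] [cite: MatarNekovar2019, Prop. 5.26 (2)] [cite: GrossLMS1991, §3 (3.2)] -/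
theorem hceb_family_three_of_unramified [Fact (Nat.Prime 3)] {N : ℕ} [NeZero N] (S : Finset ℕ)
    (hN : W.conductorNorm ℤ = N) (hirr : W.HasIrreducibleModPGaloisRep 3) (hK : IsImaginaryQuadratic K)
    (hin : ∀ ℓ ∈ S, ℓ.Prime ∧ ℓ ∣ N ∧ ¬ ℓ ^ 2 ∣ N ∧
      ((Ideal.span {(ℓ : ℤ)}).primesOver (𝓞 K)).ncard = 1 ∧ ¬ (ℓ : ℤ) ∣ NumberField.discr K)
    (hunr : ∀ ℓ : ℕ, ℓ.Prime → ℓ ∣ N → ℓ ∉ S → ¬ (ℓ : ℤ) ∣ NumberField.discr K)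
    (h3d : ¬ (3 : ℤ) ∣ NumberField.discr K) :
    ∀ (τ : K ≃ₐ[ℚ] K), τ ≠ 1 → ∀ (j : ℕ) (e₁ : ℤ), (e₁ = 1 ∨ e₁ = -1) →
      ∀ (x y : galoisCohomology ((W.baseChange K).torsionGaloisModule ((3 ^ 1 : ℕ) : ℤ)) 1),
      conjAct W τ ((3 ^ 1 : ℕ) : ℤ) x = e₁ • x → conjAct W τ ((3 ^ 1 : ℕ) : ℤ) y = (-e₁) • y → y ≠ 0 →
      ∀ (b : ℕ), ∃ ℓ : ℕ, b < ℓ ∧ IsKolyvaginPrime N W K 3 ℓ ∧ FrobEqFrobInfty W K (3 ^ (1 + j)) ℓ ∧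
        ∀ v : HeightOneSpectrum (𝓞 K), (ℓ : 𝓞 K) ∈ v.asIdeal →
          addOrderOf (galoisCohomology.localization
              ((W.baseChange K).torsionGaloisModule ((3 ^ 1 : ℕ) : ℤ)) (Sum.inr v) 1 x) = addOrderOf x ∧
          addOrderOf (galoisCohomology.localization
              ((W.baseChange K).torsionGaloisModule ((3 ^ 1 : ℕ) : ℤ)) (Sum.inr v) 1 y) = addOrderOf y := by
  refine hceb_family_three_of_unramifiedN W hN hirr hK (fun ℓ hℓ hℓN ↦ ?_) h3d
  by_cases hℓS : ℓ ∈ S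
  · exact (hin ℓ hℓS).2.2.2.2
  · exact hunr ℓ hℓ hℓN hℓS

end Summit.BirchSwinnertonDyer.Rank1Residual.X11b.Three.Koly

end
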